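import Literature.NumberTheory.EllipticCurves.PlusMinusPAdicLFunctionProofs
import Summits.BirchSwinnertonDyer.BirchSwinnertonDyer.Theorems.ResidualThetaTransportAtTwoPollackPairKUnique
import Mathlib.RingTheory.Polynomial.Cyclotomic.Roots
import Mathlib.FieldTheory.IsAlgClosed.Basic
import HarnessLib

/-!
# Route `SignedLowerHalves`, crux L `SmallImageLowerHalfBothSigns` (stmt-BirchSwinnertonDyer-23599), line `rtt_w3` v37 — row S4″ (`stub_junctionRecipMT_ns`), brick β7 (ASSEMBLY),
# LEAD g15, part 1: CYCLOTOMIC ALGEBRA FOR THE IDENTITY PRINCIPLE «values at primitive characters pin an element of 𝒪⟦T⟧»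

The S4″ closing (LEAD memo `Lines/rtt_w3-MEMO-S4prime-lead-g14.md`, β7) compares two elements of `𝒪⟦T⟧` — the image `Col(jv(s ζ̄_𝔞))` of the 𝔞-twisted elliptic-unit zeta class under
the interpolating signed Coleman map (bricks β1–β4, -w3 g28) and the signed `p`-adic `L`-function `L` pinned by the prefix's `hcongr` — through their VALUES AT PRIMITIVE CHARACTERS of
`Γ_n` only. The kernel of that comparison is: if `Φ_{pⁿ}(1+T)` divides `Z ∈ 𝒪⟦T⟧` for unboundedly many `n`, then `Z = 0` (tree: `PollackPairK.eq_zero_of_forall_dvd_of_map_eq_X_pow`).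
This file supplies the three polynomial identities that turn «the level-`n` comparison polynomial vanishes at every primitive `pⁿ`-th root of unity» into «`Φ_{pⁿ}(1+T) ∣ Z`»:
* `exists_cyclotomic_comp_X_add_one_eq_C_add_mul` — `Φ_{p^{m+1}}(1+T) = p + ω_m·H` in `ℤ[T]` (geometric sum), the Bezout-type identity that cancels the complementary half `ω_n^∓`;
* `omegaSign_succ_dvd_cyclotomicOmega` — for `n = m+1` of parity `ε`, the S4″ factor `ω_n^∓` (`ω⁻` if `ε = 1`, `ω⁺` if `ε = −1`) divides `ω_m`;
* `cyclotomic_comp_X_add_one_dvd_of_forall_isPrimitiveRoot` — over an algebraically closed field of characteristic `0`, a polynomial vanishing at `ζ − 1` for every primitive `N`-th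
  root of unity `ζ` is divisible by `Φ_N(1+T)`; with `Polynomial.map_dvd_map` this descends to `𝒪[T]`.
THEOREMS ONLY (`--supports stmt-BirchSwinnertonDyer-23599` helper); closes nothing; S4″, crux L and BSD remain OPEN and are proved for NO curve by any of this.
References: [Pollack2003] §6.5 (display before Prop. 6.18); [Washington1997] §7.1; [Kobayashi2003] Thm. 6.3 (shape of the use).
-/

set_option autoImplicit false
-- the Theorems namespace of this sub repeats the summit name by design (D-0017 nested layout)
set_option linter.dupNamespace false

noncomputable section

open Polynomial
open Literature.NumberTheory.EllipticCurves

namespace Summit.BirchSwinnertonDyer.BirchSwinnertonDyer.Theorems.SmallImageRttReciprocity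

/-! ## §1 Integer identities around `Φ_{p^{m+1}}(1+T)`, `ω_m`, `ω_n^±` -/

section IntegerIdentities

variable (p : ℕ) [hp : Fact p.Prime]

/-- **`Φ_{p^{m+1}}(1+T) = p + ω_m·H` in `ℤ[T]`**: `Φ_{p^{m+1}}(Y) = Σ_{i<p} Y^{p^m i}` and `Y^{p^m} − 1` divides each `Y^{p^m i} − 1`; at `Y = 1+T`, `Y^{p^m} − 1 = ω_m`.
[cite: Washington1997, §7.1] [folklore] -/
theorem exists_cyclotomic_comp_X_add_one_eq_C_add_mul (m : ℕ) :
    ∃ H : ℤ[X], (cyclotomic (p ^ (m + 1)) ℤ).comp (X + 1) = C (p : ℤ) + cyclotomicOmega p m * H := by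
  have hgeom : (cyclotomic (p ^ (m + 1)) ℤ).comp (X + 1) = ∑ i ∈ Finset.range p, ((X + 1) ^ p ^ m) ^ i := by
    rw [cyclotomic_prime_pow_eq_geom_sum hp.out, sum_comp]
    refine Finset.sum_congr rfl fun i _ ↦ ?_
    rw [pow_comp, pow_comp, X_comp]
  have hdvd : cyclotomicOmega p m ∣ ∑ i ∈ Finset.range p, (((X + 1) ^ p ^ m) ^ i - 1) := by
    refine Finset.dvd_sum fun i _ ↦ ?_
    have h := sub_dvd_pow_sub_pow ((X + 1 : ℤ[X]) ^ p ^ m) 1 i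
    rwa [one_pow, cyclotomicOmega] at *
  obtain ⟨H, hH⟩ := hdvd
  refine ⟨H, ?_⟩
  rw [hgeom, ← hH, Finset.sum_sub_distrib, Finset.sum_const, Finset.card_range, nsmul_eq_mul, mul_one, ← C_eq_natCast,
    eq_intCast, Int.cast_natCast]
  ring

/-- **The S4″ factor `ω_n^∓` of a level `n = m+1` of parity `ε` divides `ω_m`**: for `ε = 1` (`n` even) `ω_n^- = ω_{n-1}^-`, for `ε = −1` (`n` odd) `ω_n^+ = ω_{n-1}^+`, and
`X·ω_m^+·ω_m^- = ω_m`. [cite: Pollack2003, §6.5 (display before Prop. 6.18)] -/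
theorem omegaSign_succ_dvd_cyclotomicOmega (ε : ℤˣ) (m : ℕ) (hpar : Even (m + 1) ↔ ε = 1) :
    (if ε = 1 then cyclotomicOmegaMinus p (m + 1) else cyclotomicOmegaPlus p (m + 1)) ∣ cyclotomicOmega p m := by
  rcases Int.units_eq_one_or ε with rfl | rfl
  · rw [if_pos rfl]
    have hev : Even (m + 1) := hpar.mpr rfl
    obtain ⟨k, hk⟩ := hev
    rcases Nat.eq_zero_or_pos k with rfl | hk0
    · omega
    · have hm : m = 2 * (k - 1) + 1 := by omega
      have hm1 : m + 1 = 2 * (k - 1) + 2 := by omega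
      rw [hm1, ← cyclotomicOmegaMinus_two_mul_add_one, ← hm]
      exact (dvd_mul_left _ _).trans (Summit.BirchSwinnertonDyer.BirchSwinnertonDyer.Theorems.PollackPairK.X_mul_cyclotomicOmegaMinus_dvd p m)
  · have hne : ((-1 : ℤˣ) = 1) ↔ False := ⟨fun h ↦ by simp at h, False.elim⟩
    rw [if_neg (fun h ↦ hne.mp h)]
    have hodd : ¬ Even (m + 1) := fun h ↦ hne.mp (hpar.mp h)
    rw [Nat.not_even_iff_odd] at hodd
    obtain ⟨k, hk⟩ := hodd
    have hm : m = 2 * k := by omega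
    rw [hk, cyclotomicOmegaPlus_two_mul_add_one, ← hm]
    exact (dvd_mul_left _ _).trans (Summit.BirchSwinnertonDyer.BirchSwinnertonDyer.Theorems.PollackPairK.X_mul_cyclotomicOmegaPlus_dvd p m)

/-- `m < deg Φ_{p^{m+1}}(1+T) = p^m (p − 1)` — the degrees of the divisors used by the identity principle are unbounded. [folklore] -/
theorem lt_natDegree_cyclotomic_comp_X_add_one (m : ℕ) : m < ((cyclotomic (p ^ (m + 1)) ℤ).comp (X + 1)).natDegree := by
  have h1 : ((X : ℤ[X]) + 1) = X + C 1 := by rw [C_1]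
  rw [h1, natDegree_comp, natDegree_X_add_C, mul_one, natDegree_cyclotomic, Nat.totient_prime_pow hp.out (Nat.succ_pos m),
    Nat.succ_sub_one]
  have h2 : m < p ^ m := Nat.lt_pow_self hp.out.one_lt
  have h3 : 1 ≤ p - 1 := Nat.le_sub_one_of_lt hp.out.one_lt
  calc m < p ^ m := h2
    _ = p ^ m * 1 := (mul_one _).symm
    _ ≤ p ^ m * (p - 1) := Nat.mul_le_mul_left _ h3

end IntegerIdentities

/-! ## §2 Over an algebraically closed field of characteristic `0`: vanishing at the primitive `N`-th roots of unity, shifted by `1`, means divisibility by `Φ_N(1+T)` -/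

section Field

variable {K : Type*} [Field K] [IsAlgClosed K] [CharZero K]

/-- **`Φ_N(1+T) = ∏_{ζ primitive} (T − (ζ − 1))`** over an algebraically closed field of characteristic `0`. [folklore] -/
theorem map_cyclotomic_comp_X_add_one_eq_prod {N : ℕ} (hN : 0 < N) :
    ((cyclotomic N ℤ).comp (X + 1)).map (Int.castRingHom K) = ∏ μ ∈ primitiveRoots N K, (X - C (μ - 1)) := by
  haveI : NeZero (N : K) := ⟨Nat.cast_ne_zero.mpr hN.ne'⟩
  -- a primitive `N`-th root of unity exists (a root of `Φ_N`)
  have hdeg : (cyclotomic N K).degree ≠ 0 := by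
    rw [degree_cyclotomic]
    exact_mod_cast (Nat.totient_pos.mpr hN).ne'
  obtain ⟨z, hz⟩ := IsAlgClosed.exists_root (cyclotomic N K) hdeg
  have hprim : IsPrimitiveRoot z N := isRoot_cyclotomic_iff.mp hz
  rw [Polynomial.map_comp, map_cyclotomic_int, cyclotomic_eq_prod_X_sub_primitiveRoots hprim, Polynomial.map_add, Polynomial.map_X,
    Polynomial.map_one, Polynomial.prod_comp]
  refine Finset.prod_congr rfl fun μ _ ↦ ?_
  rw [sub_comp, X_comp, C_comp, map_sub, map_one]
  ring

/-- ★ **Vanishing at `ζ − 1` for every primitive `N`-th root of unity `ζ` ⟹ divisibility by `Φ_N(1+T)`** (`K` algebraically closed of characteristic `0`; the linear factors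
`T − (ζ−1)` are pairwise coprime). [folklore] -/
theorem cyclotomic_comp_X_add_one_dvd_of_forall_isPrimitiveRoot {N : ℕ} (hN : 0 < N) {B : K[X]}
    (hB : ∀ ζ : K, IsPrimitiveRoot ζ N → B.eval (ζ - 1) = 0) :
    ((cyclotomic N ℤ).comp (X + 1)).map (Int.castRingHom K) ∣ B := by
  rw [map_cyclotomic_comp_X_add_one_eq_prod hN]
  refine Finset.prod_dvd_of_coprime ?_ ?_
  · intro μ _ μ' _ hne
    exact isCoprime_X_sub_C_of_isUnit_sub (IsUnit.mk0 _ (sub_ne_zero.mpr fun h ↦ hne (sub_left_injective h)))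
  · intro μ hμ
    rw [dvd_iff_isRoot]
    exact hB μ ((mem_primitiveRoots hN).mp hμ)

end Field

/-! ## §3 Descent of the divisibility to a subring, and to `𝒪⟦T⟧` -/

section Descent

variable {K : Type*} [Field K] (O : Subring K)

/-- **Divisibility by `Φ_N(1+T)` descends to a subring**: if `B ∈ O[T]` and `Φ_N(1+T) ∣ B` in `K[T]`, then `Φ_N(1+T) ∣ B` in `O[T]` (monic divisor, `Polynomial.map_dvd_map`). [folklore] -/
theorem cyclotomic_comp_X_add_one_dvd_of_map_subtype_dvd (N : ℕ) {B : O[X]}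
    (h : ((cyclotomic N ℤ).comp (X + 1)).map (Int.castRingHom K) ∣ B.map O.subtype) :
    ((cyclotomic N ℤ).comp (X + 1)).map (Int.castRingHom O) ∣ B := by
  have hmonic : (((cyclotomic N ℤ).comp (X + 1)).map (Int.castRingHom O)).Monic := (monic_cyclotomic_comp_X_add_one N).map _
  rw [← Polynomial.map_dvd_map O.subtype Subtype.val_injective hmonic, Polynomial.map_map, RingHom.ext_int (O.subtype.comp (Int.castRingHom O)) (Int.castRingHom K)]
  exact h

/-- The same divisibility read in `O⟦T⟧` (the coercion `O[T] → O⟦T⟧` is a ring map). [folklore] -/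
theorem coe_cyclotomic_comp_X_add_one_dvd_coe_of_map_subtype_dvd (N : ℕ) {B : O[X]}
    (h : ((cyclotomic N ℤ).comp (X + 1)).map (Int.castRingHom K) ∣ B.map O.subtype) :
    ((((cyclotomic N ℤ).comp (X + 1)).map (Int.castRingHom O) : O[X]) : PowerSeries O) ∣ (B : PowerSeries O) := by
  obtain ⟨G, hG⟩ := cyclotomic_comp_X_add_one_dvd_of_map_subtype_dvd O N h
  exact ⟨(G : PowerSeries O), by rw [hG, Polynomial.coe_mul]⟩

end Descent

end Summit.BirchSwinnertonDyer.BirchSwinnertonDyer.Theorems.SmallImageRttReciprocity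

end
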